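import Literature.NumberTheory.EllipticCurves.ModularCurve
import Literature.NumberTheory.EllipticCurves.QuadraticTwist
import Literature.NumberTheory.EllipticCurves.GlobalMinimalModel
import Literature.NumberTheory.DiophantineGeometry.Conductor
import Mathlib.NumberTheory.Padics.PadicVal.Basic
import HarnessLib
import HarnessLib.Audit.Tags

/-!
# Candidate E-an-28 target `CommutingOrbitManinValEq p` — cell `bsd-f2-manin`, `@[conjecture]` leaf
# (NOTHING asserted; definition only; proved edges in `TwistOrbitIndexEngineOdd.lean` and
# `RamifiedTwistOptimalityCommutesProof.lean`).

HONEST FRAMING. LENS = analytic (planner `bsd-f2-manin-an` g5, MEMO-an §41; decl VERBATIM from HOME `run/shared/lean/pub/bsd-f2-manin/an/Sec24Core-g5.lean` sha16 9ed34f9b51be5933 (1181 lines, §24–§26 of the cumulative HOME `an/Sketch-an6.lean` bd37945ff22921ca over TREE imports only; farm rc 0 · 0 errors · 0 warnings · 0 sorries; MEMO-an §41–§43; CANDIDATES rows E-an-26…31), source line 640).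
Informal law: «for an odd prime `p` with `p² ∣ N`, if the `X₀`-optimal curves `E` of the class of `W`
and `E′` of the class of `W ⊗ p*` (same conductor) COMMUTE with the twist — `E′ = u • (E ⊗ p*)` over `ℚ` —
then `ord_p(c_{E′}) = ord_p(c_E)`». It is imc's landed leaf E-imc-2 `RamifiedTwistManinInvariance p`
(orbit Manin `p`-invariance for ISOGENOUS pairs, REF1 SURVIVES §R1.4, data-invisible since `c ≡ 1` in
range) RESTRICTED to commuting pairs (PROVED edge `commutingOrbitManinValEq_of_maninInvariance`); by the
§24 index engine this restriction is exactly the discriminant coupling of E-imc-7R at odd `p` (PROVED edge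
`ramifiedTwistDegreeTrichotomy_of_commutingManinValEq`), and on the `W[p]`-irreducible locus it is ALL
that remains of E-imc-2 (§26 `maninValEq_of_commuting_of_irreducible`: no flips there). NOT in print
(refuter-2: the orbit Manin invariance is asserted implicitly — and falsely without irreducibility — in
Edixhoven 1991 §4's proportionality `Λ̃ ∝ Λ`; placement R-an-18 requested); beyond-print theorem: NO
(a conjecture; Manin's conjecture `c = 1` implies it). Binder grammar of the imc leaves (globally minimal
`W`, `W′`, data at the conductor levels, lattice clauses, `u • (W ⊗ p*) = W′`).
-/

noncomputable section

open scoped MatrixGroups ModularForm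

open CongruenceSubgroup WeierstrassCurve
  Literature.NumberTheory.DiophantineGeometry
  Literature.NumberTheory.EllipticCurves
  Literature.NumberTheory.EllipticCurves.ModularForms

namespace Summit.BirchSwinnertonDyer.Rank1Residual.ManinAdditive

/-- **imc's E-imc-1b `RamifiedTwistManinInvariance p` RESTRICTED TO COMMUTING PAIRS** (`u • (W ⊗ p*) = W′`:
optimality commutes with the twist): `v_p(c′) = v_p(c)`.  By the trichotomy this restriction is EXACTLY the
discriminant coupling of E-imc-7R at odd `p` (`ramifiedTwistDegreeTrichotomy_of_commutingManinValEq` in `TwistOrbitIndexEngineOdd.lean`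
and its converse in the cell sketch, §24 of HOME/an/Sketch-an6.lean, which needs §23). Binder grammar of
the imc leaves.
[cite: Edixhoven1991, §4 (shape only: the proportionality assertion Λ̃ ∝ Λ behind orbit Manin invariance; the law is NOT in print — cell bsd-f2-manin MEMO-an §41, E-an-28)] -/
@[conjecture] def CommutingOrbitManinValEq (p : ℕ) : Prop :=
  ∀ (W W' : WeierstrassCurve ℚ) [W.IsElliptic] [W.IsGloballyMinimal] [W'.IsElliptic]
    [W'.IsGloballyMinimal] [NeZero (W.conductorNorm ℤ)] [NeZero (W'.conductorNorm ℤ)]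
    (u : VariableChange ℚ) (D : ModularParametrizationData W (W.conductorNorm ℤ))
    (D' : ModularParametrizationData W' (W'.conductorNorm ℤ)),
    (∀ z ∈ D.L.lattice, ∃ w ∈ periodLattice D.f, z = D.c * w) →
    (∀ z ∈ D'.L.lattice, ∃ w ∈ periodLattice D'.f, z = D'.c * w) →
    p ^ 2 ∣ W.conductorNorm ℤ → W'.conductorNorm ℤ = W.conductorNorm ℤ →
    u • W.quadraticTwist ((((-1 : ℤ) ^ (p / 2) * p : ℤ)) : ℚ) = W' →
    padicValInt p D'.c = padicValInt p D.c

end Summit.BirchSwinnertonDyer.Rank1Residual.ManinAdditive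

end
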